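import Summits.QuantumFields.YangMills.Theorems.AlphaInputsT3ACv3AbelianTensorSums
import Literature.MathematicalPhysics.QuantumFieldTheory.Balaban1983to89.Beta.CrossTermBounds
import HarnessLib

/-!
# `AlphaInputsT3ACv3AbelianTensorSigma` — STRATEGY B for 2′, (LL) the linear regional lift: THE SIZE OF THE SMOOTH PARTS — `Σ_y |σ(y)| ≤ 192·L^{−2k}` and
# `Σ_y |Y^{θ(y)}(y)| ≤ 768·L^{−2k}` at every finest plaquette — lane `pub-balaban3d`, seat alpha-2 (g5)

WHY.  Under the region the curl of the exact lift is `Σ_P (curl A)(P)·σ_P − Σ_{C partial} φ_C·Y_C^{θ(C)}` (plus invisible terms); with `|curl A| ≤ ε` on the region's plaquettes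
(and `|φ_C| ≤ 6ε`) the bound `|curl| ≤ C·ε·L^{−2k}` needs the two sums of this file.  Both factor over the three coordinates of the level-`k` site `y` (`Σ_y = Σ_a Σ_b Σ_c`,
`sum_site3`), and per coordinate they are the 1D coarse-index sums of `…v3AbelianShapes1DSums` §7 (`Σ_t |h| ≤ 8/L^k`, `Σ_t |g| ≤ 1`, `Σ_t |N| ≤ 3`, `Σ_t b = 1`); the hosting
corners `θ(y)` may depend on the cube arbitrarily, which is why `Y` is bounded through hosting-free envelopes.
HONEST FRAMING.  Explicit arithmetic; nothing of [B10]∕[7]∕[4] asserted; count-neutral helper toward R3 2′ (`stub_laneRecordsV3`, items 19935∕19936); registry untouched;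
nothing about d = 4, the continuum, or a mass gap.

References: T. Bałaban, Commun. Math. Phys. 102 (1985) 277–309 [Balaban1985Variational] ((8) p.279); CMP 109 (1987) 249–301 [Balaban1987RG1] ((0.4) p.253).
-/

set_option autoImplicit false

noncomputable section

namespace Summit.QuantumFields.YangMills.Theorems.AbelianEML.Tensor

open scoped BigOperators
open Literature.MathematicalPhysics.QuantumFieldTheory.Balaban1983to89
open Literature.MathematicalPhysics.QuantumFieldTheory.Balaban1983to89.T3ContinuumYM3Torus
open Summit.QuantumFields.YangMills.Theorems.AbelianEML.Shapes1D
open Literature.MathematicalPhysics.QuantumFieldTheory.Balaban1983to89 (Beta.CrossTermBounds.mul_three_le)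

variable {F : T3Family} {K k : ℕ}

/-! ## §1 Sums over the level-`k` sites factor over the coordinates -/

/-- A sum over the sites of `T^{(k)}` as a triple sum over the three coordinates. [folklore] -/
theorem sum_site3 (f : Site (F.P K) k → ℝ) :
    ∑ y, f y = ∑ a : ZMod (nc F K k), ∑ b : ZMod (nc F K k), ∑ c : ZMod (nc F K k), f (fun i => ![a, b, c] i) := by
  let e : ZMod (nc F K k) × ZMod (nc F K k) × ZMod (nc F K k) ≃ Site (F.P K) k :=
    { toFun := fun p i => ![p.1, p.2.1, p.2.2] i
      invFun := fun y => (y (0 : Fin 3), y (1 : Fin 3), y (2 : Fin 3))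
      left_inv := fun p => by simp
      right_inv := fun y => by funext i; fin_cases i <;> rfl }
  rw [← Fintype.sum_equiv e (fun p => f (e p)) f (fun _ => rfl), Fintype.sum_prod_type]
  refine Finset.sum_congr rfl fun a _ => ?_
  rw [Fintype.sum_prod_type]
  rfl

/-- A triple sum of a triple product is the product of the three sums. [folklore] -/
theorem prod_sum3 {ι : Type*} [Fintype ι] (f g h : ι → ℝ) :
    (∑ a, f a) * (∑ b, g b) * (∑ c, h c) = ∑ a, ∑ b, ∑ c, f a * g b * h c := by
  rw [Finset.sum_mul_sum, Finset.sum_mul]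
  refine Finset.sum_congr rfl fun a _ => ?_
  rw [Finset.sum_mul]
  refine Finset.sum_congr rfl fun b _ => ?_
  rw [Finset.mul_sum]

/-- The offset of a site from the coordinate triple `(a, b, c)`. [folklore] -/
theorem rho_vec (a b c : ZMod (nc F K k)) (z : Site (F.P K) 0) :
    rho (fun i => ![a, b, c] i) z 0 = (z (0 : Fin 3)).val + (N0 F K - F.L ^ k * a.val) ∧
      rho (fun i => ![a, b, c] i) z 1 = (z (1 : Fin 3)).val + (N0 F K - F.L ^ k * b.val) ∧
      rho (fun i => ![a, b, c] i) z 2 = (z (2 : Fin 3)).val + (N0 F K - F.L ^ k * c.val) := by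
  simp [rho]

/-! ## §2 The per-coordinate sums -/

section PerCoord

variable (hk : k ≤ K)
include hk

/-- `Σ_t |h^θ| ≤ 8/L^k` along one coordinate. [folklore] -/
theorem csum_h (θ : Bool) (z : Site (F.P K) 0) (i : Fin 3) :
    ∑ t : ZMod (nc F K k), |h_ F K k θ ((z i).val + (N0 F K - F.L ^ k * t.val))| ≤ 8 / ((F.L : ℝ) ^ k) := by
  obtain ⟨h1, h2, h3⟩ := sizes (F := F) hk
  rw [sum_zmod_val (fun t => |h_ F K k θ ((z i).val + (N0 F K - F.L ^ k * t))|)]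
  have := sum_coarse_abs_hS_le h1 h2 h3 θ (ZMod.val_lt (z i))
  push_cast at this
  exact this

/-- The hosting-free bond envelope: `Σ_t (|h⁰| + |h¹|) ≤ 16/L^k`. [folklore] -/
theorem csum_henv (z : Site (F.P K) 0) (i : Fin 3) :
    ∑ t : ZMod (nc F K k), (|h_ F K k false ((z i).val + (N0 F K - F.L ^ k * t.val))| + |h_ F K k true ((z i).val + (N0 F K - F.L ^ k * t.val))|) ≤
      16 / ((F.L : ℝ) ^ k) := by
  rw [Finset.sum_add_distrib]
  have h0 := csum_h hk false z i
  have h1 := csum_h hk true z i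
  have e : (16 : ℝ) / (F.L : ℝ) ^ k = 8 / (F.L : ℝ) ^ k + 8 / (F.L : ℝ) ^ k := by ring
  rw [e]; exact add_le_add h0 h1

/-- `Σ_t |g^θ| ≤ 1` along one coordinate. [folklore] -/
theorem csum_g (θ : Bool) (z : Site (F.P K) 0) (i : Fin 3) :
    ∑ t : ZMod (nc F K k), |g_ F K k θ ((z i).val + (N0 F K - F.L ^ k * t.val))| ≤ 1 := by
  obtain ⟨h1, h2, h3⟩ := sizes (F := F) hk
  rw [sum_zmod_val (fun t => |g_ F K k θ ((z i).val + (N0 F K - F.L ^ k * t))|)]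
  exact sum_coarse_abs_gS_le h1 h2 h3 θ (ZMod.val_lt (z i))

/-- The hosting-free cumulative envelope: `Σ_t (2|g⁰| + |g¹|) ≤ 3`. [folklore] -/
theorem csum_genv (z : Site (F.P K) 0) (i : Fin 3) :
    ∑ t : ZMod (nc F K k), (2 * |g_ F K k false ((z i).val + (N0 F K - F.L ^ k * t.val))| + |g_ F K k true ((z i).val + (N0 F K - F.L ^ k * t.val))|) ≤ 3 := by
  rw [Finset.sum_add_distrib, ← Finset.mul_sum]
  have h0 := csum_g hk false z i
  have h1 := csum_g hk true z i
  linarith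

/-- `Σ_t |N| ≤ 3` along one coordinate. [folklore] -/
theorem csum_N (z : Site (F.P K) 0) (i : Fin 3) :
    ∑ t : ZMod (nc F K k), |N_ F K k ((z i).val + (N0 F K - F.L ^ k * t.val))| ≤ 3 := by
  obtain ⟨h1, h2, h3⟩ := sizes (F := F) hk
  rw [sum_zmod_val (fun t => |N_ F K k ((z i).val + (N0 F K - F.L ^ k * t))|)]
  exact sum_coarse_abs_NS_le h1 h2 h3 (ZMod.val_lt (z i))

end PerCoord

/-! ## §3 The bounds on the smooth parts -/

/-- The cumulative difference against its envelope: `|g⁰ − g^θ| ≤ 2|g⁰| + |g¹|`. [folklore] -/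
theorem abs_gdiff_le (θ : Bool) (ρ : ℕ) : |g_ F K k false ρ - g_ F K k θ ρ| ≤ 2 * |g_ F K k false ρ| + |g_ F K k true ρ| := by
  cases θ
  · rw [sub_self, abs_zero]; positivity
  · calc |g_ F K k false ρ - g_ F K k true ρ| ≤ |g_ F K k false ρ| + |g_ F K k true ρ| := abs_sub _ _
      _ ≤ 2 * |g_ F K k false ρ| + |g_ F K k true ρ| := by linarith [abs_nonneg (g_ F K k false ρ)]

/-- The bond profile against its envelope: `|h^θ| ≤ |h⁰| + |h¹|`. [folklore] -/
theorem abs_h_le_env (θ : Bool) (ρ : ℕ) : |h_ F K k θ ρ| ≤ |h_ F K k false ρ| + |h_ F K k true ρ| := by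
  cases θ
  · linarith [abs_nonneg (h_ F K k true ρ)]
  · linarith [abs_nonneg (h_ F K k false ρ)]

/-- **★ THE SMOOTH PART OF THE PLAQUETTE CORRECTORS IS `O(L^{−2k})` UNIFORMLY**: `Σ_y |σ_{αβ}(y, z)| ≤ 192·(L^k)⁻²` at every finest site, every orientation.
[cite: Balaban1985Variational, (8) p.279] -/
theorem sum_abs_sig_le (hk : k ≤ K) (αβ : Fin 3) (z : Site (F.P K) 0) :
    ∑ y : Site (F.P K) k, |sig F K k αβ y z| ≤ 192 * (((F.L : ℝ) ^ k)⁻¹) ^ 2 := by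
  have hL : (0 : ℝ) < F.L := by exact_mod_cast (zero_lt_one.trans F.hL.2)
  have hn : (0 : ℝ) < (F.L : ℝ) ^ k := by positivity
  have e192 : (8 / (F.L : ℝ) ^ k) * (8 / (F.L : ℝ) ^ k) * 3 = 192 * (((F.L : ℝ) ^ k)⁻¹) ^ 2 := by field_simp; ring
  have e192' : (8 / (F.L : ℝ) ^ k) * 3 * (8 / (F.L : ℝ) ^ k) = 192 * (((F.L : ℝ) ^ k)⁻¹) ^ 2 := by field_simp; ring
  have e192'' : 3 * (8 / (F.L : ℝ) ^ k) * (8 / (F.L : ℝ) ^ k) = 192 * (((F.L : ℝ) ^ k)⁻¹) ^ 2 := by field_simp; ring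
  rw [sum_site3]
  fin_cases αβ
  · simp only [sig, Fin.zero_eta, Fin.isValue, if_true, rho_vec, abs_mul]
    rw [← prod_sum3, ← e192]
    exact Beta.CrossTermBounds.mul_three_le (Finset.sum_nonneg fun _ _ => abs_nonneg _) (Finset.sum_nonneg fun _ _ => abs_nonneg _) (Finset.sum_nonneg fun _ _ => abs_nonneg _)
      (csum_h hk false z 0) (csum_h hk false z 1) (csum_N hk z 2)
  · simp only [sig, Fin.mk_one, Fin.isValue, show ((1 : Fin 3) = 0) = False from by decide, if_true, if_false, rho_vec, abs_mul]
    rw [← prod_sum3, ← e192']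
    exact Beta.CrossTermBounds.mul_three_le (Finset.sum_nonneg fun _ _ => abs_nonneg _) (Finset.sum_nonneg fun _ _ => abs_nonneg _) (Finset.sum_nonneg fun _ _ => abs_nonneg _)
      (csum_h hk false z 0) (csum_N hk z 1) (csum_h hk false z 2)
  · simp only [sig, Fin.reduceFinMk, Fin.isValue, show ((2 : Fin 3) = 0) = False from by decide, show ((2 : Fin 3) = 1) = False from by decide, if_false,
      rho_vec, abs_mul]
    rw [← prod_sum3, ← e192'']
    exact Beta.CrossTermBounds.mul_three_le (Finset.sum_nonneg fun _ _ => abs_nonneg _) (Finset.sum_nonneg fun _ _ => abs_nonneg _) (Finset.sum_nonneg fun _ _ => abs_nonneg _)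
      (csum_N hk z 0) (csum_h hk false z 1) (csum_h hk false z 2)

/-- **★ THE SMOOTH REMAINDER OF THE CUBE CORRECTORS IS `O(L^{−2k})` UNIFORMLY, FOR ANY HOSTING ASSIGNMENT**: `Σ_y |Y^{θ(y)}_{αβ}(y, z)| ≤ 768·(L^k)⁻²`.
[cite: Balaban1985Variational, (8) p.279] -/
theorem sum_abs_Yc_le (hk : k ≤ K) (θf : Site (F.P K) k → Fin 3 → Bool) (αβ : Fin 3) (z : Site (F.P K) 0) :
    ∑ y : Site (F.P K) k, |Yc F K k (θf y) αβ y z| ≤ 768 * (((F.L : ℝ) ^ k)⁻¹) ^ 2 := by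
  have hL : (0 : ℝ) < F.L := by exact_mod_cast (zero_lt_one.trans F.hL.2)
  have hn : (0 : ℝ) < (F.L : ℝ) ^ k := by positivity
  -- hosting-free envelopes, coordinatewise
  set H : Fin 3 → ZMod (nc F K k) → ℝ := fun i t => |h_ F K k false ((z i).val + (N0 F K - F.L ^ k * t.val))| with hH
  set HE : Fin 3 → ZMod (nc F K k) → ℝ := fun i t =>
    |h_ F K k false ((z i).val + (N0 F K - F.L ^ k * t.val))| + |h_ F K k true ((z i).val + (N0 F K - F.L ^ k * t.val))| with hHE
  set GE : Fin 3 → ZMod (nc F K k) → ℝ := fun i t =>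
    2 * |g_ F K k false ((z i).val + (N0 F K - F.L ^ k * t.val))| + |g_ F K k true ((z i).val + (N0 F K - F.L ^ k * t.val))| with hGE
  have H0 : ∀ i t, 0 ≤ H i t := fun i t => abs_nonneg _
  have HE0 : ∀ i t, 0 ≤ HE i t := fun i t => by positivity
  have GE0 : ∀ i t, 0 ≤ GE i t := fun i t => by positivity
  rw [sum_site3]
  fin_cases αβ
  · -- `h⁰ ⊗ h⁰ ⊗ (g⁰ − g^θ)`
    have hle : ∀ a b c : ZMod (nc F K k), |Yc F K k (θf (fun i => ![a, b, c] i)) 0 (fun i => ![a, b, c] i) z| ≤ H 0 a * H 1 b * GE 2 c := by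
      intro a b c
      simp only [Yc, Fin.isValue, if_true, rho_vec, abs_mul, hH, hGE]
      exact mul_le_mul_of_nonneg_left (abs_gdiff_le _ _) (by positivity)
    calc ∑ a, ∑ b, ∑ c, |Yc F K k (θf (fun i => ![a, b, c] i)) 0 (fun i => ![a, b, c] i) z| ≤ ∑ a, ∑ b, ∑ c, H 0 a * H 1 b * GE 2 c :=
          Finset.sum_le_sum fun a _ => Finset.sum_le_sum fun b _ => Finset.sum_le_sum fun c _ => hle a b c
      _ = (∑ a, H 0 a) * (∑ b, H 1 b) * (∑ c, GE 2 c) := (prod_sum3 _ _ _).symm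
      _ ≤ (8 / (F.L : ℝ) ^ k) * (8 / (F.L : ℝ) ^ k) * 3 :=
          Beta.CrossTermBounds.mul_three_le (Finset.sum_nonneg fun t _ => H0 0 t) (Finset.sum_nonneg fun t _ => H0 1 t) (Finset.sum_nonneg fun t _ => GE0 2 t)
            (csum_h hk false z 0) (csum_h hk false z 1) (csum_genv hk z 2)
      _ ≤ 768 * (((F.L : ℝ) ^ k)⁻¹) ^ 2 := by
          rw [show (8 / (F.L : ℝ) ^ k) * (8 / (F.L : ℝ) ^ k) * 3 = 192 * (((F.L : ℝ) ^ k)⁻¹) ^ 2 by field_simp; ring]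
          nlinarith [sq_nonneg (((F.L : ℝ) ^ k)⁻¹)]
  · -- `h⁰ ⊗ (g⁰ − g^θ) ⊗ h^θ`
    have hle : ∀ a b c : ZMod (nc F K k), |Yc F K k (θf (fun i => ![a, b, c] i)) 1 (fun i => ![a, b, c] i) z| ≤ H 0 a * GE 1 b * HE 2 c := by
      intro a b c
      simp only [Yc, Fin.isValue, show ((1 : Fin 3) = 0) = False from by decide, if_true, if_false, rho_vec, abs_mul, abs_neg, hH, hGE, hHE]
      exact mul_le_mul (mul_le_mul_of_nonneg_left (abs_gdiff_le _ _) (abs_nonneg _)) (abs_h_le_env _ _) (abs_nonneg _) (by positivity)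
    calc ∑ a, ∑ b, ∑ c, |Yc F K k (θf (fun i => ![a, b, c] i)) 1 (fun i => ![a, b, c] i) z| ≤ ∑ a, ∑ b, ∑ c, H 0 a * GE 1 b * HE 2 c :=
          Finset.sum_le_sum fun a _ => Finset.sum_le_sum fun b _ => Finset.sum_le_sum fun c _ => hle a b c
      _ = (∑ a, H 0 a) * (∑ b, GE 1 b) * (∑ c, HE 2 c) := (prod_sum3 _ _ _).symm
      _ ≤ (8 / (F.L : ℝ) ^ k) * 3 * (16 / (F.L : ℝ) ^ k) :=
          Beta.CrossTermBounds.mul_three_le (Finset.sum_nonneg fun t _ => H0 0 t) (Finset.sum_nonneg fun t _ => GE0 1 t) (Finset.sum_nonneg fun t _ => HE0 2 t)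
            (csum_h hk false z 0) (csum_genv hk z 1) (csum_henv hk z 2)
      _ ≤ 768 * (((F.L : ℝ) ^ k)⁻¹) ^ 2 := by
          rw [show (8 / (F.L : ℝ) ^ k) * 3 * (16 / (F.L : ℝ) ^ k) = 384 * (((F.L : ℝ) ^ k)⁻¹) ^ 2 by field_simp; ring]
          nlinarith [sq_nonneg (((F.L : ℝ) ^ k)⁻¹)]
  · -- `(g⁰ − g^θ) ⊗ h^θ ⊗ h^θ`
    have hle : ∀ a b c : ZMod (nc F K k), |Yc F K k (θf (fun i => ![a, b, c] i)) 2 (fun i => ![a, b, c] i) z| ≤ GE 0 a * HE 1 b * HE 2 c := by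
      intro a b c
      simp only [Yc, Fin.isValue, show ((2 : Fin 3) = 0) = False from by decide, show ((2 : Fin 3) = 1) = False from by decide, if_false, rho_vec, abs_mul,
        hGE, hHE]
      exact mul_le_mul (mul_le_mul (abs_gdiff_le _ _) (abs_h_le_env _ _) (abs_nonneg _) (by positivity)) (abs_h_le_env _ _) (abs_nonneg _) (by positivity)
    calc ∑ a, ∑ b, ∑ c, |Yc F K k (θf (fun i => ![a, b, c] i)) 2 (fun i => ![a, b, c] i) z| ≤ ∑ a, ∑ b, ∑ c, GE 0 a * HE 1 b * HE 2 c :=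
          Finset.sum_le_sum fun a _ => Finset.sum_le_sum fun b _ => Finset.sum_le_sum fun c _ => hle a b c
      _ = (∑ a, GE 0 a) * (∑ b, HE 1 b) * (∑ c, HE 2 c) := (prod_sum3 _ _ _).symm
      _ ≤ 3 * (16 / (F.L : ℝ) ^ k) * (16 / (F.L : ℝ) ^ k) :=
          Beta.CrossTermBounds.mul_three_le (Finset.sum_nonneg fun t _ => GE0 0 t) (Finset.sum_nonneg fun t _ => HE0 1 t) (Finset.sum_nonneg fun t _ => HE0 2 t)
            (csum_genv hk z 0) (csum_henv hk z 1) (csum_henv hk z 2)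
      _ ≤ 768 * (((F.L : ℝ) ^ k)⁻¹) ^ 2 := by
          rw [show 3 * (16 / (F.L : ℝ) ^ k) * (16 / (F.L : ℝ) ^ k) = 768 * (((F.L : ℝ) ^ k)⁻¹) ^ 2 by field_simp; ring]

end Summit.QuantumFields.YangMills.Theorems.AbelianEML.Tensor

end
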